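import Summits.AtomisticToContinuum.FouriersLaw.Theorems.OddSectorIrreversibilityOddCorrectorDecayGibbsMoments
import Summits.AtomisticToContinuum.FouriersLaw.Theorems.OddSectorIrreversibilityOddCorrectorDecayCurrentVarianceD
import Summits.AtomisticToContinuum.FouriersLaw.Theorems.OddSectorIrreversibilityOddCorrectorDecayClosedFlow
import Literature.MathematicalPhysics.KineticTheory.OddSectorLocalityHypothesis

/-!
# Static inputs of the bath-locality estimate in the crux vocabulary (`gibbsWeight`, `currentNormSq`)

Support file for item `stmt-AtomisticToContinuum-9139` (`OddSectorIrreversibility.OddCorrectorDecay`), negative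
side. The crux measures everything against the unnormalised Gibbs weight `μ_T = e^{-H_N/T} dq dp`
(`OddSectorLocality.gibbsWeight`, a `withDensity` measure) while the static estimates of
`ChainVariation` are real integrals against `ρ = e^{-H/T}`; this file transports them:
* `lintegral_gibbsWeight_eq`, `gibbsWeight_univ`, `lintegral_ofReal_gibbsWeight_eq` — the dictionary
  `∫⁻ g dμ_T = ∫⁻ g ρ`, `μ_T(univ) = ∫ ρ`, `∫⁻ g dμ_T = ∫ g ρ` for `g ≥ 0` with `gρ ∈ L¹`;
* `lintegral_momentum_pow_gibbsWeight_le` — `∫ p_i^{2j} dμ_T ≤ (2j)! T^j μ_T(univ)`;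
* `exists_const_lintegral_exp_mul_coord_sq_le` — `∫ e^{κ q_k²} dμ_T ≤ C_κ μ_T(univ)` uniformly in `N, k`
  (quartic pinning `lam > 0`);
* `exists_const_lintegral_oneSiteSum_le` — the ONE-SITE SUM `Ψ_κ(x) = ∑_i (e^{κ q_i²} + p_i^{12} + 1)` that
  dominates every local weight of the pathwise comparison has `∫ Ψ_κ dμ_T ≤ C N μ_T(univ)`;
* `currentNormSq_eq_integral`, `exists_const_currentNormSq_ge` — `M_N = ∫ J² ρ` and the extensivity
  `M_{n+3} ≥ c (n+1) μ_T(univ)` (`ChainVariation.pinnedChain_integral_totalCurrent_sq_ge`).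
-/

noncomputable section

open MeasureTheory Set Finset
open scoped ENNReal NNReal
open Literature.MathematicalPhysics.KineticTheory Literature.MathematicalPhysics.KineticTheory.HeatConduction
open Literature.MathematicalPhysics.KineticTheory.OddSectorLocality
open Summit.AtomisticToContinuum.FouriersLaw.Theorems.ClosedChainFlow (measurable_gibbsWeightDensity)
open Summit.AtomisticToContinuum.FouriersLaw.Theorems.ChainVariation

namespace Summit.AtomisticToContinuum.FouriersLaw.Theorems.OddCorrectorBathLocality

section Weight

variable {ω₂ lam β : ℝ} (hω : 0 < ω₂) (hl : 0 ≤ lam) (hβ : 0 ≤ β) (γ : ℝ) {T : ℝ} (hT : 0 < T)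

/-- `∫⁻ g dμ_T = ∫⁻ g ρ dx` with `ρ = e^{-H/T}`. [folklore] -/
theorem lintegral_gibbsWeight_eq (T : ℝ) (N : ℕ) {g : PhaseSpace N → ℝ≥0∞} (hg : Measurable g) :
    ∫⁻ x, g x ∂(gibbsWeight ω₂ lam β γ T N) =
      ∫⁻ x, g x * ENNReal.ofReal (Real.exp (-(pinnedChain ω₂ lam β γ).hamiltonian N x / T)) := by
  unfold gibbsWeight
  rw [lintegral_withDensity_eq_lintegral_mul _ (measurable_gibbsWeightDensity ω₂ lam β γ T N) hg]
  refine lintegral_congr fun x => ?_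
  simp only [Pi.mul_apply]
  rw [mul_comm]

/-- `μ_T(univ) = ∫⁻ ρ dx`. [folklore] -/
theorem gibbsWeight_univ_eq_lintegral (T : ℝ) (N : ℕ) :
    gibbsWeight ω₂ lam β γ T N univ =
      ∫⁻ x, ENNReal.ofReal (Real.exp (-(pinnedChain ω₂ lam β γ).hamiltonian N x / T)) := by
  unfold gibbsWeight
  rw [withDensity_apply _ MeasurableSet.univ, Measure.restrict_univ]

include hω hl hβ hT

/-- `μ_T(univ) = ∫ ρ dx` (`ρ` is integrable for `ω₂ > 0`, `lam, β ≥ 0`, `T > 0`). [folklore] -/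
theorem gibbsWeight_univ (N : ℕ) :
    gibbsWeight ω₂ lam β γ T N univ = ENNReal.ofReal (∫ x, (pinnedChain ω₂ lam β γ).gibbsDensity N T x) := by
  rw [gibbsWeight_univ_eq_lintegral, ofReal_integral_eq_lintegral_ofReal
    (pinnedChain_integrable_gibbsDensity hω hl hβ γ N hT)
    (ae_of_all _ fun x => ((pinnedChain ω₂ lam β γ).gibbsDensity_pos N T x).le)]
  rfl

/-- `0 < ∫ ρ dx`. [folklore] -/
theorem integral_gibbsDensity_pos (N : ℕ) : 0 < ∫ x, (pinnedChain ω₂ lam β γ).gibbsDensity N T x :=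
  integral_exp_pos (pinnedChain_integrable_gibbsDensity hω hl hβ γ N hT)

/-- `μ_T` is a finite measure. [folklore] -/
theorem isFiniteMeasure_gibbsWeight (N : ℕ) : IsFiniteMeasure (gibbsWeight ω₂ lam β γ T N) := by
  refine ⟨?_⟩
  rw [gibbsWeight_univ hω hl hβ γ hT]
  exact ENNReal.ofReal_lt_top

/-- `μ_T(univ) ≠ 0`. [folklore] -/
theorem gibbsWeight_univ_ne_zero (N : ℕ) : gibbsWeight ω₂ lam β γ T N univ ≠ 0 := by
  rw [gibbsWeight_univ hω hl hβ γ hT]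
  exact (ENNReal.ofReal_pos.2 (integral_gibbsDensity_pos hω hl hβ γ hT N)).ne'

omit hω hl hβ hT in
/-- For `g ≥ 0` with `g ρ ∈ L¹`: `∫⁻ g dμ_T = ∫ g ρ dx`. [folklore] -/
theorem lintegral_ofReal_gibbsWeight_eq (N : ℕ) {g : PhaseSpace N → ℝ} (hgm : Measurable g) (hg0 : ∀ x, 0 ≤ g x)
    (hint : Integrable fun x => g x * (pinnedChain ω₂ lam β γ).gibbsDensity N T x) :
    ∫⁻ x, ENNReal.ofReal (g x) ∂(gibbsWeight ω₂ lam β γ T N) =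
      ENNReal.ofReal (∫ x, g x * (pinnedChain ω₂ lam β γ).gibbsDensity N T x) := by
  rw [lintegral_gibbsWeight_eq γ T N hgm.ennreal_ofReal, ofReal_integral_eq_lintegral_ofReal hint
    (ae_of_all _ fun x => mul_nonneg (hg0 x) ((pinnedChain ω₂ lam β γ).gibbsDensity_pos N T x).le)]
  refine lintegral_congr fun x => ?_
  rw [← ENNReal.ofReal_mul (hg0 x)]
  rfl

/-- **Momentum moments against `μ_T`**: `∫ p_i^{2j} dμ_T ≤ (2j)! T^j μ_T(univ)`. [folklore] -/
theorem lintegral_momentum_pow_gibbsWeight_le (N : ℕ) (i : Fin N) (j : ℕ) :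
    ∫⁻ x, ENNReal.ofReal ((x.2 i) ^ (2 * j)) ∂(gibbsWeight ω₂ lam β γ T N) ≤
      ENNReal.ofReal (((2 * j).factorial : ℝ) * T ^ j) * gibbsWeight ω₂ lam β γ T N univ := by
  have h0 : ∀ x : PhaseSpace N, 0 ≤ x.2 i ^ (2 * j) := fun x => by rw [pow_mul]; positivity
  rw [lintegral_ofReal_gibbsWeight_eq γ N (by fun_prop) h0
    (pinnedChain_integrable_momentum_pow_mul_gibbsDensity_all hω hl hβ γ N hT i (2 * j)),
    gibbsWeight_univ hω hl hβ γ hT, ← ENNReal.ofReal_mul (by positivity)]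
  exact ENNReal.ofReal_le_ofReal (pinnedChain_integral_momentum_even_pow_le hω hl hβ γ N hT i j)

omit hω hl hβ hT in
/-- `M_N = ∫ J² ρ dx` (the crux's `currentNormSq` as a real integral against the density). [folklore] -/
theorem currentNormSq_eq_integral (N : ℕ) :
    currentNormSq ω₂ lam β γ T N =
      ∫ x, (∑ i, (pinnedChain ω₂ lam β γ).bondCurrent N i x) ^ 2 * (pinnedChain ω₂ lam β γ).gibbsDensity N T x := by
  unfold currentNormSq gibbsWeight
  rw [integral_withDensity_eq_integral_toReal_smul (measurable_gibbsWeightDensity ω₂ lam β γ T N)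
    (ae_of_all _ fun _ => ENNReal.ofReal_lt_top)]
  refine integral_congr_ae (ae_of_all _ fun x => ?_)
  simp only
  rw [ENNReal.toReal_ofReal (Real.exp_pos _).le, smul_eq_mul, mul_comm]
  rfl

/-- **Extensivity of the current norm in the crux vocabulary**: there is `c > 0` (depending on
`ω₂, lam, β, T` only) with `c (n+1) μ_T(univ) ≤ M_{n+3}` for every `n`
(`ChainVariation.pinnedChain_integral_totalCurrent_sq_ge`). [folklore] -/
theorem exists_const_currentNormSq_ge :
    ∃ c : ℝ, 0 < c ∧ ∀ n : ℕ,
      c * (n + 1) * (gibbsWeight ω₂ lam β γ T (n + 3) univ).toReal ≤ currentNormSq ω₂ lam β γ T (n + 3) := by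
  have h := fun n => pinnedChain_integral_totalCurrent_sq_ge hω hl hβ γ hT n
  refine ⟨_, div_pos (pow_pos hT 3) (mul_pos four_pos (h 0).1), fun n => ?_⟩
  rw [gibbsWeight_univ hω hl hβ γ hT, ENNReal.toReal_ofReal (integral_gibbsDensity_pos hω hl hβ γ hT _).le,
    currentNormSq_eq_integral]
  exact (h n).2

end Weight

section Quartic

variable {ω₂ lam β : ℝ} (hω : 0 < ω₂) (hl : 0 < lam) (hβ : 0 ≤ β) (γ : ℝ) {T : ℝ} (hT : 0 < T)
include hω hl hβ hT

/-- **Exponential position moments against `μ_T`, uniformly in `N` and the site** (quartic pinning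
`lam > 0`): for `κ ≥ 0` there is `C ≥ 0` with `∫ e^{κ q_k²} dμ_T ≤ C μ_T(univ)` for all `N, k`. [folklore] -/
theorem exists_const_lintegral_exp_mul_coord_sq_le {κ : ℝ} (hκ : 0 ≤ κ) :
    ∃ C : ℝ, 0 ≤ C ∧ ∀ (N : ℕ) (k : Fin N),
      ∫⁻ x, ENNReal.ofReal (Real.exp (κ * (x.1 k) ^ 2)) ∂(gibbsWeight ω₂ lam β γ T N) ≤
        ENNReal.ofReal C * gibbsWeight ω₂ lam β γ T N univ := by
  set A := ∫⁻ a, ENNReal.ofReal (Real.exp (κ * a ^ 2)) *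
    ENNReal.ofReal (Real.exp (-(pinnedChain ω₂ lam β γ).U a / T)) with hA
  set ZU := ∫⁻ a, ENNReal.ofReal (Real.exp (-(pinnedChain ω₂ lam β γ).U a / T)) with hZU
  have hAfin : A ≠ ⊤ := pinnedChain_lintegral_exp_mul_sq_mul_exp_neg_U_ne_top hω hl γ hT κ
  have hZU0 : ZU ≠ 0 := SubdiffusiveBondHeat.pinnedChain_lintegral_exp_neg_U_ne_zero ω₂ lam β γ T
  have hfin : A / ZU ≠ ⊤ := (ENNReal.div_lt_top hAfin hZU0).ne
  refine ⟨(A / ZU).toReal, ENNReal.toReal_nonneg, fun N k => ?_⟩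
  rw [ENNReal.ofReal_toReal hfin, lintegral_gibbsWeight_eq γ T N (by fun_prop), gibbsWeight_univ_eq_lintegral]
  exact pinnedChain_lintegral_exp_mul_coord_sq_le hω hl hβ γ hT N k hκ

/-- **The one-site sum `Ψ_κ = ∑_i (e^{κ q_i²} + p_i^{12} + 1)` has `∫ Ψ_κ dμ_T ≤ C N μ_T(univ)`** with `C`
depending on `ω₂, lam, β, T, κ` only. [folklore] -/
theorem exists_const_lintegral_oneSiteSum_le {κ : ℝ} (hκ : 0 ≤ κ) :
    ∃ C : ℝ, 0 ≤ C ∧ ∀ N : ℕ,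
      ∫⁻ x, ENNReal.ofReal (∑ i : Fin N, (Real.exp (κ * (x.1 i) ^ 2) + (x.2 i) ^ 12 + 1))
          ∂(gibbsWeight ω₂ lam β γ T N) ≤
        ENNReal.ofReal (C * N) * gibbsWeight ω₂ lam β γ T N univ := by
  obtain ⟨C₁, hC₁, h₁⟩ := exists_const_lintegral_exp_mul_coord_sq_le hω hl hβ γ hT hκ
  set C : ℝ := C₁ + ((2 * 6).factorial : ℝ) * T ^ 6 + 1 with hC
  have hC0 : 0 ≤ C := by positivity
  refine ⟨C, hC0, fun N => ?_⟩
  set μ := gibbsWeight ω₂ lam β γ T N with hμ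
  have hp0 : ∀ (x : PhaseSpace N) (i : Fin N), 0 ≤ x.2 i ^ 12 := fun x i =>
    by rw [show (12:ℕ) = 2 * 6 from rfl, pow_mul]; positivity
  have hterm : ∀ i : Fin N,
      ∫⁻ x, ENNReal.ofReal (Real.exp (κ * (x.1 i) ^ 2) + (x.2 i) ^ 12 + 1) ∂μ ≤ ENNReal.ofReal C * μ univ := by
    intro i
    have e : (fun x : PhaseSpace N => ENNReal.ofReal (Real.exp (κ * (x.1 i) ^ 2) + (x.2 i) ^ 12 + 1)) =
        fun x => ENNReal.ofReal (Real.exp (κ * (x.1 i) ^ 2)) + ENNReal.ofReal ((x.2 i) ^ (2 * 6)) + 1 := by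
      funext x
      rw [ENNReal.ofReal_add (by positivity) zero_le_one, ENNReal.ofReal_add (by positivity) (hp0 x i),
        ENNReal.ofReal_one]
    have hm1 : Measurable fun x : PhaseSpace N => ENNReal.ofReal (Real.exp (κ * (x.1 i) ^ 2)) := by fun_prop
    have hm2 : Measurable fun x : PhaseSpace N => ENNReal.ofReal ((x.2 i) ^ (2 * 6)) := by fun_prop
    rw [e, lintegral_add_right _ measurable_const, lintegral_add_left hm1, lintegral_const]
    calc ∫⁻ x, ENNReal.ofReal (Real.exp (κ * (x.1 i) ^ 2)) ∂μ + ∫⁻ x, ENNReal.ofReal ((x.2 i) ^ (2 * 6)) ∂μ + 1 * μ univ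
        ≤ ENNReal.ofReal C₁ * μ univ + ENNReal.ofReal (((2 * 6).factorial : ℝ) * T ^ 6) * μ univ + 1 * μ univ :=
          add_le_add (add_le_add (h₁ N i) (lintegral_momentum_pow_gibbsWeight_le hω hl.le hβ γ hT N i 6)) le_rfl
      _ = ENNReal.ofReal C * μ univ := by
          rw [hC, ENNReal.ofReal_add (by positivity) zero_le_one, ENNReal.ofReal_add hC₁ (by positivity),
            ENNReal.ofReal_one]
          ring
  calc ∫⁻ x, ENNReal.ofReal (∑ i : Fin N, (Real.exp (κ * (x.1 i) ^ 2) + (x.2 i) ^ 12 + 1)) ∂μ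
      = ∫⁻ x, ∑ i : Fin N, ENNReal.ofReal (Real.exp (κ * (x.1 i) ^ 2) + (x.2 i) ^ 12 + 1) ∂μ := by
        refine lintegral_congr fun x => ?_
        exact ENNReal.ofReal_sum_of_nonneg fun i _ => by have := hp0 x i; positivity
    _ = ∑ i : Fin N, ∫⁻ x, ENNReal.ofReal (Real.exp (κ * (x.1 i) ^ 2) + (x.2 i) ^ 12 + 1) ∂μ :=
        lintegral_finsetSum _ fun i _ => by fun_prop
    _ ≤ ∑ _i : Fin N, ENNReal.ofReal C * μ univ := Finset.sum_le_sum fun i _ => hterm i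
    _ = ENNReal.ofReal (C * N) * μ univ := by
        rw [Finset.sum_const, Finset.card_univ, Fintype.card_fin, nsmul_eq_mul, ← mul_assoc,
          ENNReal.ofReal_mul hC0, ENNReal.ofReal_natCast, mul_comm (ENNReal.ofReal C)]

end Quartic

end Summit.AtomisticToContinuum.FouriersLaw.Theorems.OddCorrectorBathLocality

end
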